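import Mathlib
import HarnessLib
import Summits.AnomalousDissipation.AnomalousDissipation.Theses.NeutralTaylorWaves
import Summits.AnomalousDissipation.AnomalousDissipation.Theorems.NeutralTaylorWavesNonresonantSelectionSpineReduction

/-!
# Skeleton line `kolmogorov-cell-wave-operator` — crux `NeutralTaylorWaves.NonresonantSelection`
(stmt-AnomalousDissipation-16294)

Idea (card `Cruxes/NonresonantSelection/Ideas/kolmogorov-cell-wave-operator.md`, triage r1: 3 × pass as
"a MODULE settling the short-wave sector S1; the mean/long-wave sector MS stays delegated"):
SECTOR SPLITTING OF THE REDUCED GAP AT THE SPINE. The crux is literally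
`TaylorWaveQuasiSteady → NonresonantTaylorWaves`; by the landed reduction
`Theorems.nonresonantSelection_of_spineCore` (p163791) it follows from SPINE-CORE DATA: one reference
family (the spine `(w₁ n, c₁ n)`) carrying, for infinitely many `n`, Keller data with largeness
`Λ_n = C₀ν_n^{-K₀}` — in particular the REDUCED GAP `‖u‖₂ ≤ Λ_n ‖A₁(u,r)‖₂` on test fields
`u ⊥ ∂₃w₁` — plus a coherent all-orders quasi-steady family. Line `birth` left exactly this spine core
open as ONE stub (`stub_spineCore`), handed back by the lead as crux-sized.

This line cuts the reduced gap along the physics of the Taylor-wave cell. Frozen at a point of the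
slow modulation, the linearised steady operator `A₁` is the steady Orr–Sommerfeld operator of a
KOLMOGOROV SHEAR PROFILE `U₀ cos y` at cell viscosity `ε`, horizontal cell wavenumber `α` (streamwise component `γ`, Squire); in the
SHORT-WAVE SECTOR `α² > 1` that operator obeys an a-priori bound with polynomial constant
`ε(α² - 1)`, by pairing with the Arnold-form multiplier `-(∂² - α² + 1)φ` (the second variation of
Arnold's conserved form `∫(Δφ)² - |∇φ|²`, positive exactly on the short torus — Arnold, Mathematical
Methods, App. 2 §J Ex. 2; long waves are Meshalkin–Sinai unstable). So:

* `stub_kolmogorovCellBound` (the MODULE; universal, Mathlib-only, TRUE lemma, size M): the steady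
  Orr–Sommerfeld a-priori bound for the Kolmogorov profile with drift, short-wave sector, any `ε > 0`:
  `ε(α²-1)‖ω‖₂² ≤ ‖T_{ε,α} φ‖₂ ‖ω‖₂`, `ω = φ'' - α²φ`.
* `stub_sectorGluing` (universal torus-level FESHBACH/GÅRDING GLUING in a-priori form, TRUE lemma,
  size M): if a multiplier `B` (`‖Bu‖₂ ≤ β‖u‖₂`) gives the Gårding inequality
  `m₁‖u - Pu‖₂² ≤ ⟨A₁(u,r), Bu⟩ + m₂‖Pu‖₂²` and the low sector obeys `‖Pu‖₂ ≤ M‖A₁(u,r)‖₂` on the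
  bordered test class, then `‖u‖₂ ≤ (3M + (β + M m₂)/m₁) ‖A₁(u,r)‖₂` there.
* `stub_sectorSplitSpine` (hardest, XL; the construction + K2 + the delegated MS sector): the
  spine-core data of `birth` with the reduced-gap clause REPLACED by a sector splitting `(B, P)` at
  each selected `n`: `‖B‖ ≤ Λ_n`, the Gårding inequality with `(m₁, m₂) = (1, Λ_n)` CONDITIONAL ON the
  cell bound (this is where the module is consumed: frozen cell bound ⇒ high-sector coercivity along
  the modulated family), and the low-sector a-priori bound with constant `Λ_n`; kernel/cokernel
  smallness is asked at level `(5Λ_n³)⁻³` and coherence `9K₀ + 3 ≤ a`, because the glued gap constant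
  is `4Λ_n + Λ_n² ≤ 5Λ_n³`. With `P = id`, `B = 0` the splitting clauses collapse to `birth`'s reduced
  gap, so this stub is implied by (a constant-shifted) `stub_spineCore`; the converse is the content
  of this file.

Composition `NonresonantSelection_of : S₁ → S₂ → S₃ → NonresonantSelection` (no `sorry`): unpack the
family, discharge the conditional Gårding clause with the cell bound, glue the sectors with
`stub_sectorGluing` (`β = m₂ = M = Λ_n`, `m₁ = 1`), bound `4Λ_n + Λ_n² ≤ 5Λ_n³ = (5C₀³)ν_n^{-3K₀}`,
and feed `Theorems.nonresonantSelection_of_spineCore` with `(C₀, K₀) ↦ (5C₀³, 3K₀)`.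
`NonresonantSelection_proof` is the same composition with the registered stubs BY NAME.
All stub signatures are in tree vocabulary (no skeleton-local definition inside a signature).
-/

set_option linter.dupNamespace false

noncomputable section

namespace Summit.AnomalousDissipation.AnomalousDissipation.Cruxes.NonresonantSelection.KolmogorovCellWaveOperator

open MeasureTheory Set Filter Topology Function
open Literature.Analysis.FunctionSpaces
open Summit.AnomalousDissipation.AnomalousDissipation.Theses.NeutralTaylorWaves

/-! ### Stub 1 — the module: Kolmogorov cell bound in the short-wave sector -/

/-- **Stub `stub_kolmogorovCellBound` (the S1 module; universal, Mathlib-only).**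
Steady Orr–Sommerfeld a-priori bound for the Kolmogorov profile `U₀ cos y` with drift `s`, cell
viscosity `ε > 0`, horizontal wavenumber `α` in the SHORT-WAVE sector `α² > 1` (for an oblique mode
`e^{i(γx' + βz')}` of the cell, `α² = γ² + β²` and `γ` is the streamwise component — Squire's reduction;
the statement lets `γ` be any real): for every `2π`-periodic `C⁴` amplitude `φ : ℝ → ℂ`, with
`ω = φ'' - α²φ` and `Tφ = ε(φ'''' - 2α²φ'' + α⁴φ) - iγ(U₀ cos y - s)(φ'' - α²φ) - iγ U₀ cos y · φ`
(viscous term `ε(∂²-α²)²φ`, Rayleigh term `-iγ[(U-s)(∂²-α²)φ - U''φ]` with `U = U₀ cos y`, `U'' = -U`),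
`ε(α²-1) ∫₀^{2π} ‖ω‖² ≤ (∫₀^{2π} ‖Tφ‖²)^{1/2} (∫₀^{2π} ‖ω‖²)^{1/2}`.
Why true: pair `Tφ` with the Arnold-form multiplier `-(ω + φ) = -(∂² - α² + 1)φ`; two integrations by
parts give `Re⟨ε(∂²-α²)ω, -(ω+φ)⟩ = ε‖ω'‖² + ε(α²-1)‖ω‖²`, while the Rayleigh part pairs to
`iγU₀∫cos y‖ω+φ‖² - iγs(‖ω‖² - ‖φ'‖² - α²‖φ‖²)`, purely imaginary; and `‖ω+φ‖₂ ≤ ‖ω‖₂` since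
`α² ≥ 1`. The constant `ε(α²-1)` is uniform in the amplitude `U₀` (no degradation at band edges) and in
the drift `s`. Numerically stress-tested (work/check_stubs.py: 20000 random trigonometric polynomials,
no violation, min slack ratio 1.04; the long-wave control `α² < 1` does fail). Size M (interval-integral
integration by parts for periodic `C⁴` functions, Cauchy–Schwarz).
Sources: Arnold, Mathematical Methods of Classical Mechanics, App. 2 §J Example 2 (short torus);
Meshalkin–Sinai 1961 (doi:10.1016/0021-8928(62)90149-1); arXiv:1801.05645 Thm 1.1/Prop 5.1,
arXiv:1711.01822 §2.2 (sharper, enhanced-dissipation versions, not needed here). -/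
theorem stub_kolmogorovCellBound :
    ∀ (ε U₀ s α γ : ℝ) (φ : ℝ → ℂ), 0 < ε → 1 < α ^ 2 →
      Function.Periodic φ (2 * Real.pi) → ContDiff ℝ 4 φ →
      ε * (α ^ 2 - 1) *
          (∫ y in (0 : ℝ)..(2 * Real.pi), ‖iteratedDeriv 2 φ y - (α : ℂ) ^ 2 * φ y‖ ^ 2) ≤
        Real.sqrt (∫ y in (0 : ℝ)..(2 * Real.pi),
            ‖(ε : ℂ) * (iteratedDeriv 4 φ y - 2 * (α : ℂ) ^ 2 * iteratedDeriv 2 φ y + (α : ℂ) ^ 4 * φ y) -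
                Complex.I * (γ : ℂ) * ((U₀ * Real.cos y - s : ℝ) : ℂ) *
                  (iteratedDeriv 2 φ y - (α : ℂ) ^ 2 * φ y) -
                Complex.I * (γ : ℂ) * ((U₀ * Real.cos y : ℝ) : ℂ) * φ y‖ ^ 2) *
          Real.sqrt (∫ y in (0 : ℝ)..(2 * Real.pi), ‖iteratedDeriv 2 φ y - (α : ℂ) ^ 2 * φ y‖ ^ 2) := by
  sorry

/-! ### Stub 2 — sector gluing (Feshbach / Gårding, a-priori form) -/

/-- **Stub `stub_sectorGluing` (universal, torus level).** Let `A(u,r) = w·∇u + u·∇w - νΔu + ∇r - c∂₃u`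
be the steady operator linearised at a smooth base `w` with drift `c`, and let `B`, `P` be
smoothness-preserving maps on vector fields with `‖Bu‖₂ ≤ β‖u‖₂`. If on the bordered test class
(`u` smooth divergence-free mean-zero with `⟨u, ∂₃w⟩ = 0`, `r` smooth) the GÅRDING inequality
`m₁‖u - Pu‖₂² ≤ ⟨A(u,r), Bu⟩ + m₂‖Pu‖₂²` (`m₁ > 0`) and the LOW-SECTOR a-priori bound
`‖Pu‖₂ ≤ M‖A(u,r)‖₂` hold, then `‖u‖₂ ≤ (3M + (β + M m₂)/m₁)‖A(u,r)‖₂` on that class.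
Why true: with `d = ‖u-Pu‖₂`, `p = ‖Pu‖₂ ≤ M a`, `a = ‖A(u,r)‖₂`, `X = ‖u‖₂ ≤ d + p`, Cauchy–Schwarz gives
`m₁d² ≤ βaX + m₂p²`, so `d ≤ (X + βa/m₁)/2 + p(1 + m₂/m₁)/2`, whence `X ≤ βa/m₁ + 3p + p m₂/m₁`.
Size M (L² bookkeeping on the torus: smooth ⇒ integrable, Minkowski, Cauchy–Schwarz, real endgame).
Sources: Sjöstrand–Zworski, Elementary linear algebra for advanced spectral problems, Ann. Inst.
Fourier 57 (2007) (arXiv:math/0312166), §2 (Schur complement / Grushin–Feshbach reduction). -/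
theorem stub_sectorGluing :
    ∀ (ν c m₁ m₂ β M : ℝ) (w : UnitAddTorus (Fin 3) → EuclideanSpace ℝ (Fin 3))
      (Bop P : (UnitAddTorus (Fin 3) → EuclideanSpace ℝ (Fin 3)) →
        UnitAddTorus (Fin 3) → EuclideanSpace ℝ (Fin 3)),
      0 < m₁ → 0 ≤ m₂ → 0 ≤ β → 0 ≤ M → Torus.IsSmooth w →
      (∀ u : UnitAddTorus (Fin 3) → EuclideanSpace ℝ (Fin 3), Torus.IsSmooth u →
        Torus.IsSmooth (Bop u) ∧ Torus.IsSmooth (P u) ∧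
          (∫ x, ‖Bop u x‖ ^ 2) ≤ β ^ 2 * ∫ x, ‖u x‖ ^ 2) →
      (∀ (u : UnitAddTorus (Fin 3) → EuclideanSpace ℝ (Fin 3)) (r : UnitAddTorus (Fin 3) → ℝ),
        Torus.IsSmooth u → Torus.IsSmooth r → Torus.IsDivFree u → Torus.HasZeroMean u →
        (∫ x, inner ℝ (u x) (Torus.partialDeriv (2 : Fin 3) w x)) = 0 →
        m₁ * (∫ x, ‖u x - P u x‖ ^ 2) ≤
          (∫ x, inner ℝ (Torus.convect w u x + Torus.convect u w x - ν • Torus.laplacian u x +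
              Torus.gradient r x - c • Torus.partialDeriv (2 : Fin 3) u x) (Bop u x)) +
            m₂ * ∫ x, ‖P u x‖ ^ 2) →
      (∀ (u : UnitAddTorus (Fin 3) → EuclideanSpace ℝ (Fin 3)) (r : UnitAddTorus (Fin 3) → ℝ),
        Torus.IsSmooth u → Torus.IsSmooth r → Torus.IsDivFree u → Torus.HasZeroMean u →
        (∫ x, inner ℝ (u x) (Torus.partialDeriv (2 : Fin 3) w x)) = 0 →
        Real.sqrt (∫ x, ‖P u x‖ ^ 2) ≤
          M * Real.sqrt (∫ x, ‖Torus.convect w u x + Torus.convect u w x - ν • Torus.laplacian u x +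
              Torus.gradient r x - c • Torus.partialDeriv (2 : Fin 3) u x‖ ^ 2)) →
      ∀ (u : UnitAddTorus (Fin 3) → EuclideanSpace ℝ (Fin 3)) (r : UnitAddTorus (Fin 3) → ℝ),
        Torus.IsSmooth u → Torus.IsSmooth r → Torus.IsDivFree u → Torus.HasZeroMean u →
        (∫ x, inner ℝ (u x) (Torus.partialDeriv (2 : Fin 3) w x)) = 0 →
        Real.sqrt (∫ x, ‖u x‖ ^ 2) ≤
          (3 * M + (β + M * m₂) / m₁) *
            Real.sqrt (∫ x, ‖Torus.convect w u x + Torus.convect u w x - ν • Torus.laplacian u x +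
              Torus.gradient r x - c • Torus.partialDeriv (2 : Fin 3) u x‖ ^ 2) := by
  sorry

/-! ### Stub 3 — the spine with a sector splitting (construction + K2 + delegated MS sector) -/

/-- **Stub `stub_sectorSplitSpine` (hardest, XL).** IF `TaylorWaveQuasiSteady`, THEN there are one smooth
divergence-free mean-zero force `f`, `ν_n → 0⁺`, `E`, `ε₀ > 0`, `C₀ ≥ 1`, `K₀`, `9K₀ + 3 ≤ a`, a smooth
divergence-free SPINE `(w₁ n, c₁ n)` and, for infinitely many `n` (`ν_n ≤ 1`), with `Λ_n = C₀ν_n^{-K₀}`: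
Keller data as in `birth` — `ψ` (`‖ψ‖₂ ≤ 1`), `q₃`, `Λ_n⁻¹ ≤ ‖∂₃w₁‖₂ ≤ Λ_n`, `Λ_n|⟨ψ,∂₃w₁⟩| ≥ 1`,
approximate kernel `‖A₁(∂₃w₁,q₃)‖₂ ≤ (5Λ_n³)⁻³`, approximate cokernel `2|⟨ψ,A₁(v,r)⟩| ≤ (5Λ_n³)⁻³‖v‖₂` —
and, INSTEAD OF the reduced gap, a SECTOR SPLITTING: smoothness-preserving maps `B` (multiplier,
`‖Bu‖₂ ≤ Λ_n‖u‖₂`) and `P` (low / mean–long-wave sector) such that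
(K2) IF the Kolmogorov cell bound (`stub_kolmogorovCellBound`, verbatim) holds THEN the Gårding
inequality `‖u - Pu‖₂² ≤ ⟨A₁(u,r), Bu⟩ + Λ_n‖Pu‖₂²` holds on the bordered test class (`u ⊥ ∂₃w₁`), and
(MS) the low sector obeys `‖Pu‖₂ ≤ Λ_n‖A₁(u,r)‖₂` there; plus, for every order `K`, the all-`n`
quasi-steady family with the target's sup bounds, `ν_n^a`-close to the spine (verbatim from `birth`).
Why plausibly true: `P = id`, `B = 0` reduces it to `birth`'s `stub_spineCore` (so it is implied by the
line the lead already judged plausible); the intended witness takes `P` = projection onto streamwise cell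
wavenumbers `|α| ≤ 1` plus the modulation band-edge collar, `B` = the high-sector Arnold multiplier cut
at `K₁ ≫ 1` so that the frozen-coefficient coercivity `~ K₁²|∇S|²` absorbs the `O(1)` modulation and
collar commutators (triage k1–k3 sharpenings), leaving the genuinely open MS bound as the one
family-specific spectral input. Why it might fail: the MS sector (mean flows `α = 0` and long waves
`0 < |α| ≤ 1`, Meshalkin–Sinai unstable inviscidly) may carry pseudomodes of `A₁` at polynomial level.
Sources: arXiv:math/0402408 (Taylor-wave families); Arnold App. 2 §J; doi:10.1002/cpa.20004 (DSZ
pseudospectra); `Cruxes/NonresonantSelection/Lines/birth.md`. -/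
theorem stub_sectorSplitSpine :
    TaylorWaveQuasiSteady →
    ∃ f : UnitAddTorus (Fin 3) → EuclideanSpace ℝ (Fin 3),
      Torus.IsSmooth f ∧ Torus.IsDivFree f ∧ Torus.HasZeroMean f ∧
    ∃ (ν : ℕ → ℝ) (E ε₀ C₀ : ℝ) (K₀ a : ℕ)
      (w₁ : ℕ → UnitAddTorus (Fin 3) → EuclideanSpace ℝ (Fin 3)) (c₁ : ℕ → ℝ),
      (∀ n, 0 < ν n) ∧ Tendsto ν atTop (𝓝 0) ∧ 0 < ε₀ ∧ 1 ≤ C₀ ∧ 9 * K₀ + 3 ≤ a ∧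
      (∀ n, Torus.IsSmooth (w₁ n) ∧ Torus.IsDivFree (w₁ n)) ∧
      (∀ N : ℕ, ∃ n : ℕ, N ≤ n ∧ ν n ≤ 1 ∧
        ∃ (ψ : UnitAddTorus (Fin 3) → EuclideanSpace ℝ (Fin 3)) (q₃ : UnitAddTorus (Fin 3) → ℝ),
          Torus.IsSmooth ψ ∧ Torus.IsSmooth q₃ ∧ (∫ x, ‖ψ x‖ ^ 2) ≤ 1 ∧
          Real.sqrt (∫ x, ‖Torus.partialDeriv (2 : Fin 3) (w₁ n) x‖ ^ 2) ≤ C₀ * (ν n)⁻¹ ^ K₀ ∧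
          1 ≤ C₀ * (ν n)⁻¹ ^ K₀ * Real.sqrt (∫ x, ‖Torus.partialDeriv (2 : Fin 3) (w₁ n) x‖ ^ 2) ∧
          1 ≤ C₀ * (ν n)⁻¹ ^ K₀ * |∫ x, inner ℝ (ψ x) (Torus.partialDeriv (2 : Fin 3) (w₁ n) x)| ∧
          Real.sqrt (∫ x, ‖Torus.convect (w₁ n) (Torus.partialDeriv (2 : Fin 3) (w₁ n)) x +
              Torus.convect (Torus.partialDeriv (2 : Fin 3) (w₁ n)) (w₁ n) x -
              (ν n) • Torus.laplacian (Torus.partialDeriv (2 : Fin 3) (w₁ n)) x + Torus.gradient q₃ x -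
              (c₁ n) • Torus.partialDeriv (2 : Fin 3) (Torus.partialDeriv (2 : Fin 3) (w₁ n)) x‖ ^ 2) ≤
            (5 * C₀ ^ 3 * (ν n)⁻¹ ^ (3 * K₀))⁻¹ ^ 3 ∧
          (∀ (v : UnitAddTorus (Fin 3) → EuclideanSpace ℝ (Fin 3)) (r : UnitAddTorus (Fin 3) → ℝ),
            Torus.IsSmooth v → Torus.IsSmooth r → Torus.IsDivFree v → Torus.HasZeroMean v →
            2 * |∫ x, inner ℝ (ψ x) (Torus.convect (w₁ n) v x + Torus.convect v (w₁ n) x -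
                (ν n) • Torus.laplacian v x + Torus.gradient r x -
                (c₁ n) • Torus.partialDeriv (2 : Fin 3) v x)| ≤
              (5 * C₀ ^ 3 * (ν n)⁻¹ ^ (3 * K₀))⁻¹ ^ 3 * Real.sqrt (∫ x, ‖v x‖ ^ 2)) ∧
          ∃ (Bop P : (UnitAddTorus (Fin 3) → EuclideanSpace ℝ (Fin 3)) →
              UnitAddTorus (Fin 3) → EuclideanSpace ℝ (Fin 3)),
            (∀ u : UnitAddTorus (Fin 3) → EuclideanSpace ℝ (Fin 3), Torus.IsSmooth u →
              Torus.IsSmooth (Bop u) ∧ Torus.IsSmooth (P u) ∧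
                (∫ x, ‖Bop u x‖ ^ 2) ≤ (C₀ * (ν n)⁻¹ ^ K₀) ^ 2 * ∫ x, ‖u x‖ ^ 2) ∧
            ((∀ (ε U₀ s α γ : ℝ) (φ : ℝ → ℂ), 0 < ε → 1 < α ^ 2 →
                Function.Periodic φ (2 * Real.pi) → ContDiff ℝ 4 φ →
                ε * (α ^ 2 - 1) *
                    (∫ y in (0 : ℝ)..(2 * Real.pi), ‖iteratedDeriv 2 φ y - (α : ℂ) ^ 2 * φ y‖ ^ 2) ≤
                  Real.sqrt (∫ y in (0 : ℝ)..(2 * Real.pi),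
                      ‖(ε : ℂ) * (iteratedDeriv 4 φ y - 2 * (α : ℂ) ^ 2 * iteratedDeriv 2 φ y +
                            (α : ℂ) ^ 4 * φ y) -
                          Complex.I * (γ : ℂ) * ((U₀ * Real.cos y - s : ℝ) : ℂ) *
                            (iteratedDeriv 2 φ y - (α : ℂ) ^ 2 * φ y) -
                          Complex.I * (γ : ℂ) * ((U₀ * Real.cos y : ℝ) : ℂ) * φ y‖ ^ 2) *
                    Real.sqrt (∫ y in (0 : ℝ)..(2 * Real.pi),
                      ‖iteratedDeriv 2 φ y - (α : ℂ) ^ 2 * φ y‖ ^ 2)) →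
              ∀ (u : UnitAddTorus (Fin 3) → EuclideanSpace ℝ (Fin 3)) (r : UnitAddTorus (Fin 3) → ℝ),
                Torus.IsSmooth u → Torus.IsSmooth r → Torus.IsDivFree u → Torus.HasZeroMean u →
                (∫ x, inner ℝ (u x) (Torus.partialDeriv (2 : Fin 3) (w₁ n) x)) = 0 →
                1 * (∫ x, ‖u x - P u x‖ ^ 2) ≤
                  (∫ x, inner ℝ (Torus.convect (w₁ n) u x + Torus.convect u (w₁ n) x -
                      (ν n) • Torus.laplacian u x + Torus.gradient r x -
                      (c₁ n) • Torus.partialDeriv (2 : Fin 3) u x) (Bop u x)) +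
                    C₀ * (ν n)⁻¹ ^ K₀ * ∫ x, ‖P u x‖ ^ 2) ∧
            (∀ (u : UnitAddTorus (Fin 3) → EuclideanSpace ℝ (Fin 3)) (r : UnitAddTorus (Fin 3) → ℝ),
              Torus.IsSmooth u → Torus.IsSmooth r → Torus.IsDivFree u → Torus.HasZeroMean u →
              (∫ x, inner ℝ (u x) (Torus.partialDeriv (2 : Fin 3) (w₁ n) x)) = 0 →
              Real.sqrt (∫ x, ‖P u x‖ ^ 2) ≤
                C₀ * (ν n)⁻¹ ^ K₀ * Real.sqrt (∫ x, ‖Torus.convect (w₁ n) u x + Torus.convect u (w₁ n) x -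
                  (ν n) • Torus.laplacian u x + Torus.gradient r x -
                  (c₁ n) • Torus.partialDeriv (2 : Fin 3) u x‖ ^ 2))) ∧
      ∀ K : ℕ, ∃ C : ℝ, ∀ n : ℕ,
        ∃ (w : UnitAddTorus (Fin 3) → EuclideanSpace ℝ (Fin 3)) (q : UnitAddTorus (Fin 3) → ℝ) (c : ℝ),
          Torus.IsSmooth w ∧ Torus.IsSmooth q ∧ Torus.IsDivFree w ∧ Torus.HasZeroMean w ∧ |c| ≤ C ∧
          (∫ x, ‖w x‖ ^ 2) ≤ E ∧
          |ν n * Torus.gradNormSq w - ε₀| ≤ C * Real.sqrt (ν n) ∧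
          (∫ x, ‖Torus.convect w w x - (ν n) • Torus.laplacian w x + Torus.gradient q x -
              c • Torus.partialDeriv (2 : Fin 3) w x - f x‖ ^ 2) ≤ C * (ν n) ^ K ∧
          (∀ x, ‖w x‖ ≤ C) ∧ (∀ (i : Fin 3) x, ‖Torus.partialDeriv i w x‖ ≤ C * (ν n)⁻¹) ∧
          (∀ (i j : Fin 3) x, ‖Torus.partialDeriv i (Torus.partialDeriv j w) x‖ ≤ C * (ν n)⁻¹ ^ 2) ∧
          (∀ x, ‖w x - w₁ n x‖ ≤ C * (ν n) ^ a) ∧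
          (∀ (i : Fin 3) x, ‖Torus.partialDeriv i w x - Torus.partialDeriv i (w₁ n) x‖ ≤ C * (ν n) ^ a) ∧
          |c - c₁ n| ≤ C * (ν n) ^ a := by
  sorry

/-! ### Composition — the crux from the three stubs (no `sorry` below this line) -/

/-- **The crux from the three stubs, by statement.** `S₁ → S₂ → S₃ → NonresonantSelection`:
the cell bound discharges the conditional Gårding clause of the family, the gluing lemma turns
(Gårding + low-sector bound) into the reduced gap with constant `3Λ + (Λ + Λ·Λ)/1 ≤ 5Λ³`,
`Λ = C₀ν_n^{-K₀}`, and the landed reduction `Theorems.nonresonantSelection_of_spineCore` closes with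
`(C₀, K₀) ↦ (5C₀³, 3K₀)`. -/
theorem NonresonantSelection_of
    (h₁ : ∀ (ε U₀ s α γ : ℝ) (φ : ℝ → ℂ), 0 < ε → 1 < α ^ 2 →
      Function.Periodic φ (2 * Real.pi) → ContDiff ℝ 4 φ →
      ε * (α ^ 2 - 1) *
          (∫ y in (0 : ℝ)..(2 * Real.pi), ‖iteratedDeriv 2 φ y - (α : ℂ) ^ 2 * φ y‖ ^ 2) ≤
        Real.sqrt (∫ y in (0 : ℝ)..(2 * Real.pi),
            ‖(ε : ℂ) * (iteratedDeriv 4 φ y - 2 * (α : ℂ) ^ 2 * iteratedDeriv 2 φ y + (α : ℂ) ^ 4 * φ y) -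
                Complex.I * (γ : ℂ) * ((U₀ * Real.cos y - s : ℝ) : ℂ) *
                  (iteratedDeriv 2 φ y - (α : ℂ) ^ 2 * φ y) -
                Complex.I * (γ : ℂ) * ((U₀ * Real.cos y : ℝ) : ℂ) * φ y‖ ^ 2) *
          Real.sqrt (∫ y in (0 : ℝ)..(2 * Real.pi), ‖iteratedDeriv 2 φ y - (α : ℂ) ^ 2 * φ y‖ ^ 2))
    (h₂ : ∀ (ν c m₁ m₂ β M : ℝ) (w : UnitAddTorus (Fin 3) → EuclideanSpace ℝ (Fin 3))
      (Bop P : (UnitAddTorus (Fin 3) → EuclideanSpace ℝ (Fin 3)) →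
        UnitAddTorus (Fin 3) → EuclideanSpace ℝ (Fin 3)),
      0 < m₁ → 0 ≤ m₂ → 0 ≤ β → 0 ≤ M → Torus.IsSmooth w →
      (∀ u : UnitAddTorus (Fin 3) → EuclideanSpace ℝ (Fin 3), Torus.IsSmooth u →
        Torus.IsSmooth (Bop u) ∧ Torus.IsSmooth (P u) ∧
          (∫ x, ‖Bop u x‖ ^ 2) ≤ β ^ 2 * ∫ x, ‖u x‖ ^ 2) →
      (∀ (u : UnitAddTorus (Fin 3) → EuclideanSpace ℝ (Fin 3)) (r : UnitAddTorus (Fin 3) → ℝ),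
        Torus.IsSmooth u → Torus.IsSmooth r → Torus.IsDivFree u → Torus.HasZeroMean u →
        (∫ x, inner ℝ (u x) (Torus.partialDeriv (2 : Fin 3) w x)) = 0 →
        m₁ * (∫ x, ‖u x - P u x‖ ^ 2) ≤
          (∫ x, inner ℝ (Torus.convect w u x + Torus.convect u w x - ν • Torus.laplacian u x +
              Torus.gradient r x - c • Torus.partialDeriv (2 : Fin 3) u x) (Bop u x)) +
            m₂ * ∫ x, ‖P u x‖ ^ 2) →
      (∀ (u : UnitAddTorus (Fin 3) → EuclideanSpace ℝ (Fin 3)) (r : UnitAddTorus (Fin 3) → ℝ),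
        Torus.IsSmooth u → Torus.IsSmooth r → Torus.IsDivFree u → Torus.HasZeroMean u →
        (∫ x, inner ℝ (u x) (Torus.partialDeriv (2 : Fin 3) w x)) = 0 →
        Real.sqrt (∫ x, ‖P u x‖ ^ 2) ≤
          M * Real.sqrt (∫ x, ‖Torus.convect w u x + Torus.convect u w x - ν • Torus.laplacian u x +
              Torus.gradient r x - c • Torus.partialDeriv (2 : Fin 3) u x‖ ^ 2)) →
      ∀ (u : UnitAddTorus (Fin 3) → EuclideanSpace ℝ (Fin 3)) (r : UnitAddTorus (Fin 3) → ℝ),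
        Torus.IsSmooth u → Torus.IsSmooth r → Torus.IsDivFree u → Torus.HasZeroMean u →
        (∫ x, inner ℝ (u x) (Torus.partialDeriv (2 : Fin 3) w x)) = 0 →
        Real.sqrt (∫ x, ‖u x‖ ^ 2) ≤
          (3 * M + (β + M * m₂) / m₁) *
            Real.sqrt (∫ x, ‖Torus.convect w u x + Torus.convect u w x - ν • Torus.laplacian u x +
              Torus.gradient r x - c • Torus.partialDeriv (2 : Fin 3) u x‖ ^ 2))
    (h₃ : TaylorWaveQuasiSteady →
    ∃ f : UnitAddTorus (Fin 3) → EuclideanSpace ℝ (Fin 3),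
      Torus.IsSmooth f ∧ Torus.IsDivFree f ∧ Torus.HasZeroMean f ∧
    ∃ (ν : ℕ → ℝ) (E ε₀ C₀ : ℝ) (K₀ a : ℕ)
      (w₁ : ℕ → UnitAddTorus (Fin 3) → EuclideanSpace ℝ (Fin 3)) (c₁ : ℕ → ℝ),
      (∀ n, 0 < ν n) ∧ Tendsto ν atTop (𝓝 0) ∧ 0 < ε₀ ∧ 1 ≤ C₀ ∧ 9 * K₀ + 3 ≤ a ∧
      (∀ n, Torus.IsSmooth (w₁ n) ∧ Torus.IsDivFree (w₁ n)) ∧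
      (∀ N : ℕ, ∃ n : ℕ, N ≤ n ∧ ν n ≤ 1 ∧
        ∃ (ψ : UnitAddTorus (Fin 3) → EuclideanSpace ℝ (Fin 3)) (q₃ : UnitAddTorus (Fin 3) → ℝ),
          Torus.IsSmooth ψ ∧ Torus.IsSmooth q₃ ∧ (∫ x, ‖ψ x‖ ^ 2) ≤ 1 ∧
          Real.sqrt (∫ x, ‖Torus.partialDeriv (2 : Fin 3) (w₁ n) x‖ ^ 2) ≤ C₀ * (ν n)⁻¹ ^ K₀ ∧
          1 ≤ C₀ * (ν n)⁻¹ ^ K₀ * Real.sqrt (∫ x, ‖Torus.partialDeriv (2 : Fin 3) (w₁ n) x‖ ^ 2) ∧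
          1 ≤ C₀ * (ν n)⁻¹ ^ K₀ * |∫ x, inner ℝ (ψ x) (Torus.partialDeriv (2 : Fin 3) (w₁ n) x)| ∧
          Real.sqrt (∫ x, ‖Torus.convect (w₁ n) (Torus.partialDeriv (2 : Fin 3) (w₁ n)) x +
              Torus.convect (Torus.partialDeriv (2 : Fin 3) (w₁ n)) (w₁ n) x -
              (ν n) • Torus.laplacian (Torus.partialDeriv (2 : Fin 3) (w₁ n)) x + Torus.gradient q₃ x -
              (c₁ n) • Torus.partialDeriv (2 : Fin 3) (Torus.partialDeriv (2 : Fin 3) (w₁ n)) x‖ ^ 2) ≤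
            (5 * C₀ ^ 3 * (ν n)⁻¹ ^ (3 * K₀))⁻¹ ^ 3 ∧
          (∀ (v : UnitAddTorus (Fin 3) → EuclideanSpace ℝ (Fin 3)) (r : UnitAddTorus (Fin 3) → ℝ),
            Torus.IsSmooth v → Torus.IsSmooth r → Torus.IsDivFree v → Torus.HasZeroMean v →
            2 * |∫ x, inner ℝ (ψ x) (Torus.convect (w₁ n) v x + Torus.convect v (w₁ n) x -
                (ν n) • Torus.laplacian v x + Torus.gradient r x -
                (c₁ n) • Torus.partialDeriv (2 : Fin 3) v x)| ≤
              (5 * C₀ ^ 3 * (ν n)⁻¹ ^ (3 * K₀))⁻¹ ^ 3 * Real.sqrt (∫ x, ‖v x‖ ^ 2)) ∧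
          ∃ (Bop P : (UnitAddTorus (Fin 3) → EuclideanSpace ℝ (Fin 3)) →
              UnitAddTorus (Fin 3) → EuclideanSpace ℝ (Fin 3)),
            (∀ u : UnitAddTorus (Fin 3) → EuclideanSpace ℝ (Fin 3), Torus.IsSmooth u →
              Torus.IsSmooth (Bop u) ∧ Torus.IsSmooth (P u) ∧
                (∫ x, ‖Bop u x‖ ^ 2) ≤ (C₀ * (ν n)⁻¹ ^ K₀) ^ 2 * ∫ x, ‖u x‖ ^ 2) ∧
            ((∀ (ε U₀ s α γ : ℝ) (φ : ℝ → ℂ), 0 < ε → 1 < α ^ 2 →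
                Function.Periodic φ (2 * Real.pi) → ContDiff ℝ 4 φ →
                ε * (α ^ 2 - 1) *
                    (∫ y in (0 : ℝ)..(2 * Real.pi), ‖iteratedDeriv 2 φ y - (α : ℂ) ^ 2 * φ y‖ ^ 2) ≤
                  Real.sqrt (∫ y in (0 : ℝ)..(2 * Real.pi),
                      ‖(ε : ℂ) * (iteratedDeriv 4 φ y - 2 * (α : ℂ) ^ 2 * iteratedDeriv 2 φ y +
                            (α : ℂ) ^ 4 * φ y) -
                          Complex.I * (γ : ℂ) * ((U₀ * Real.cos y - s : ℝ) : ℂ) *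
                            (iteratedDeriv 2 φ y - (α : ℂ) ^ 2 * φ y) -
                          Complex.I * (γ : ℂ) * ((U₀ * Real.cos y : ℝ) : ℂ) * φ y‖ ^ 2) *
                    Real.sqrt (∫ y in (0 : ℝ)..(2 * Real.pi),
                      ‖iteratedDeriv 2 φ y - (α : ℂ) ^ 2 * φ y‖ ^ 2)) →
              ∀ (u : UnitAddTorus (Fin 3) → EuclideanSpace ℝ (Fin 3)) (r : UnitAddTorus (Fin 3) → ℝ),
                Torus.IsSmooth u → Torus.IsSmooth r → Torus.IsDivFree u → Torus.HasZeroMean u →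
                (∫ x, inner ℝ (u x) (Torus.partialDeriv (2 : Fin 3) (w₁ n) x)) = 0 →
                1 * (∫ x, ‖u x - P u x‖ ^ 2) ≤
                  (∫ x, inner ℝ (Torus.convect (w₁ n) u x + Torus.convect u (w₁ n) x -
                      (ν n) • Torus.laplacian u x + Torus.gradient r x -
                      (c₁ n) • Torus.partialDeriv (2 : Fin 3) u x) (Bop u x)) +
                    C₀ * (ν n)⁻¹ ^ K₀ * ∫ x, ‖P u x‖ ^ 2) ∧
            (∀ (u : UnitAddTorus (Fin 3) → EuclideanSpace ℝ (Fin 3)) (r : UnitAddTorus (Fin 3) → ℝ),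
              Torus.IsSmooth u → Torus.IsSmooth r → Torus.IsDivFree u → Torus.HasZeroMean u →
              (∫ x, inner ℝ (u x) (Torus.partialDeriv (2 : Fin 3) (w₁ n) x)) = 0 →
              Real.sqrt (∫ x, ‖P u x‖ ^ 2) ≤
                C₀ * (ν n)⁻¹ ^ K₀ * Real.sqrt (∫ x, ‖Torus.convect (w₁ n) u x + Torus.convect u (w₁ n) x -
                  (ν n) • Torus.laplacian u x + Torus.gradient r x -
                  (c₁ n) • Torus.partialDeriv (2 : Fin 3) u x‖ ^ 2))) ∧
      ∀ K : ℕ, ∃ C : ℝ, ∀ n : ℕ,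
        ∃ (w : UnitAddTorus (Fin 3) → EuclideanSpace ℝ (Fin 3)) (q : UnitAddTorus (Fin 3) → ℝ) (c : ℝ),
          Torus.IsSmooth w ∧ Torus.IsSmooth q ∧ Torus.IsDivFree w ∧ Torus.HasZeroMean w ∧ |c| ≤ C ∧
          (∫ x, ‖w x‖ ^ 2) ≤ E ∧
          |ν n * Torus.gradNormSq w - ε₀| ≤ C * Real.sqrt (ν n) ∧
          (∫ x, ‖Torus.convect w w x - (ν n) • Torus.laplacian w x + Torus.gradient q x -
              c • Torus.partialDeriv (2 : Fin 3) w x - f x‖ ^ 2) ≤ C * (ν n) ^ K ∧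
          (∀ x, ‖w x‖ ≤ C) ∧ (∀ (i : Fin 3) x, ‖Torus.partialDeriv i w x‖ ≤ C * (ν n)⁻¹) ∧
          (∀ (i j : Fin 3) x, ‖Torus.partialDeriv i (Torus.partialDeriv j w) x‖ ≤ C * (ν n)⁻¹ ^ 2) ∧
          (∀ x, ‖w x - w₁ n x‖ ≤ C * (ν n) ^ a) ∧
          (∀ (i : Fin 3) x, ‖Torus.partialDeriv i w x - Torus.partialDeriv i (w₁ n) x‖ ≤ C * (ν n) ^ a) ∧
          |c - c₁ n| ≤ C * (ν n) ^ a) :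
    Summit.AnomalousDissipation.AnomalousDissipation.Theses.NeutralTaylorWaves.NonresonantSelection := by
  refine Theorems.nonresonantSelection_of_spineCore fun hH => ?_
  obtain ⟨f, hf, hfdiv, hfmean, ν, E, ε₀, C₀, K₀, a, w₁, c₁, hνpos, hνlim, hε₀, hC₀, ha, hw₁, hcore,
    hfam⟩ := h₃ hH
  refine ⟨f, hf, hfdiv, hfmean, ν, E, ε₀, 5 * C₀ ^ 3, 3 * K₀, a, w₁, c₁, hνpos, hνlim, hε₀, ?_, ?_,
    hw₁, ?_, hfam⟩
  · have h1 : 1 ≤ C₀ ^ 3 := one_le_pow₀ hC₀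
    linarith
  · omega
  intro N
  obtain ⟨n, hn, hν1, ψ, q₃, hψ, hq₃, hψ1, hΦle, hΦge, hpair, hker, hcoker, Bop, P, hBP, hG, hMS⟩ :=
    hcore N
  -- the largeness parameter `Λ = C₀ ν_n^{-K₀} ≥ 1` and the glued constant `4Λ + Λ² ≤ 5Λ³`
  have hx0 : 0 < ν n := hνpos n
  have hy1 : 1 ≤ (ν n)⁻¹ ^ K₀ := one_le_pow₀ ((one_le_inv₀ hx0).2 hν1)
  set Λ : ℝ := C₀ * (ν n)⁻¹ ^ K₀ with hΛ_def
  have hΛ1 : 1 ≤ Λ := by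
    have := mul_le_mul hC₀ hy1 zero_le_one (zero_le_one.trans hC₀)
    simpa [hΛ_def] using this
  have hΛ0 : 0 ≤ Λ := zero_le_one.trans hΛ1
  have hΛe : 5 * Λ ^ 3 = 5 * C₀ ^ 3 * (ν n)⁻¹ ^ (3 * K₀) := by
    rw [hΛ_def, mul_pow, ← pow_mul, mul_comm K₀ 3]; ring
  have h13 : Λ ≤ Λ ^ 3 := le_self_pow₀ hΛ1 (by norm_num)
  have h23 : Λ ^ 2 ≤ Λ ^ 3 := pow_le_pow_right₀ hΛ1 (by norm_num)
  have hΛle : Λ ≤ 5 * C₀ ^ 3 * (ν n)⁻¹ ^ (3 * K₀) := by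
    rw [← hΛe]
    linarith [h13, pow_nonneg hΛ0 3]
  have hgapC : 3 * Λ + (Λ + Λ * Λ) / 1 ≤ 5 * C₀ ^ 3 * (ν n)⁻¹ ^ (3 * K₀) := by
    rw [div_one, ← hΛe]
    have h2 : Λ * Λ ≤ Λ ^ 3 := by rw [← sq]; exact h23
    linarith [h13, h2]
  -- the reduced gap on `(∂₃w₁)^⊥` from the sector splitting, glued by stub 2 fed with stub 1
  have key := h₂ (ν n) (c₁ n) 1 Λ Λ Λ (w₁ n) Bop P one_pos hΛ0 hΛ0 hΛ0 (hw₁ n).1 hBP (hG h₁) hMS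
  refine ⟨n, hn, hν1, ψ, q₃, hψ, hq₃, hψ1, hΦle.trans hΛle,
    hΦge.trans (mul_le_mul_of_nonneg_right hΛle (Real.sqrt_nonneg _)),
    hpair.trans (mul_le_mul_of_nonneg_right hΛle (abs_nonneg _)), hker, hcoker, ?_⟩
  intro u r hu hr hudiv humean hperp
  exact (key u r hu hr hudiv humean hperp).trans
    (mul_le_mul_of_nonneg_right hgapC (Real.sqrt_nonneg _))

/-- **The crux, composed from the registered stubs BY NAME** (its only `sorry`s are the stubs'). -/
theorem NonresonantSelection_proof : NonresonantSelection :=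
  NonresonantSelection_of stub_kolmogorovCellBound stub_sectorGluing stub_sectorSplitSpine

end Summit.AnomalousDissipation.AnomalousDissipation.Cruxes.NonresonantSelection.KolmogorovCellWaveOperator

end
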